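import Literature.NumberTheory.LFunctions.DeBruijnNewman
import Literature.NumberTheory.LFunctions.ZetaZeros
import HarnessLib

/-!
# Rodgers–Tao 2020: the zeros `x_j(t)` of `H_t`, the classical locations `ξ_j`, and the
renormalised energy; the energy bound at time zero (Prop. 8.1)

Trunk T-ANT (`Literature/NumberTheory/LFunctions`). Second decomposition file (D-0014 named
facts) for the discharge of `Literature.NumberTheory.LFunctions.rodgers_tao` (`Equivalents.lean`, rh.S28; Rodgers–Tao,
*The de Bruijn–Newman constant is non-negative*, Forum Math. Pi 8 (2020), e6 = arXiv:1801.05914,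
Thm. 1.1 `Λ ≥ 0`). The first file, `RodgersTao.lean`, cut the printed proof at the display
(picketfence) of §9. This file supplies the notions in which §§3–8 of the paper are written, so
that the cut can be moved one step up, to

> **Proposition 8.1** (Energy bound at time zero). Let `T` be large. Then
> `Ẽ^{[T log T, 2T log T]}(0) = o_{T → ∞}(T log³ T)`,

from which §9 obtains (picketfence) by Markov's inequality, and further to the two results
from which §8 obtains Prop. 8.1,

> **Theorem 7.2** (Strong control on integrated energy).
> `∫_{Λ/4}^0 Ẽ^{[½T log T, 3T log T]}(t) dt = o_{T → ∞}(T log³ T)`;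
>
> **Proposition 8.2** (Energy propagation inequality). For large `T`, windows
> `[T log T, 2T log T] ⊆ I = [I₁, I₂] ⊆ [½T log T, 3T log T]` and times
> `Λ/4 ≤ t₁ ≤ t₂ ≤ 0`, `t₂ ≤ t₁ + 1/(100 log² T)`:
> `Ẽ^{I'}(t₂) ≤ Ẽ^{I}(t₁) + Õ(1)`, `I' = [I₁ + log³ T, I₂ − log³ T]`

(both deductions are proved in the companion file `RodgersTaoEnergyProofs.lean`). Section and
equation numbers are those of the arXiv version.

## Contents

Definitions (namespace `Literature`; all junk-free under the paper's standing hypothesis `Λ < 0`, see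
the individual docstrings for the junk conventions):

* `Literature.NumberTheory.LFunctions.rodgersTaoPsi` — `Ψ(T) = (T/4π) log(T/4π) − T/4π` (eq. (8) of §3), the main term of the
  Riemann–von Mangoldt formula for `H_0`: `N_0([0,T]) = Ψ(T) + O(log T)`;
* `Literature.NumberTheory.LFunctions.classicalLocation` — the classical location `ξ_y`, the unique `ξ ≥ 4π` with `Ψ(ξ) = y`
  (`y ≥ −1`; the paper uses integer `y = j ≥ 1`, display (10) of §3), with the API
  `Literature.NumberTheory.LFunctions.rodgersTaoPsi_classicalLocation`, `Literature.NumberTheory.LFunctions.four_pi_le_classicalLocation`,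
  `Literature.NumberTheory.LFunctions.classicalLocation_rodgersTaoPsi`, `Literature.NumberTheory.LFunctions.strictMonoOn_classicalLocation`;
* `Literature.deBruijnZeroCount t I` — `N_t(I)`, the number of real zeros of `H_t` in `I ⊆ ℝ` (§3);
* `Literature.deBruijnZero t j` — `x_j(t)`, the `j`-th positive real zero of `H_t` (§1.2);
* `Literature.NumberTheory.LFunctions.renormPotential` — `V(x) = 1/x² − 1 + 2(|x| − 1)` (§7);
* `Literature.renormEnergy t j k` — `Ẽ_{jk}(t) = V((x_k(t) − x_j(t))/(ξ_k − ξ_j)) / |ξ_k − ξ_j|²` and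
  `Literature.renormEnergyOn t I` — `Ẽ^I(t) = Σ_{j,k ∈ I, j ≠ k} Ẽ_{jk}(t)` (§7).

Named facts (namespace `Literature.RH`, hypotheses `sInf`-free as in `RodgersTao.lean`):

* `Literature.NumberTheory.LFunctions.rodgers_tao_energy_bound_zero` — Prop. 8.1 (it rests on all of §§2–8);
* `Literature.NumberTheory.LFunctions.rodgers_tao_integrated_energy_bound` — Thm. 7.2 (§§2–7), with `Λ/4` replaced by
  `t₀/4 ≥ Λ/4` for the witness `t₀` of `Λ < 0` (a weaker integral of a non-negative function);
* `Literature.NumberTheory.LFunctions.rodgers_tao_energy_propagation` — Prop. 8.2 (Bourgain's pigeonholing; Lemma 4.2,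
  Cor. 3.3, Lemma 7.1), likewise for times in `[t₀/4, 0]`;
* `Literature.NumberTheory.LFunctions.rodgers_tao_zeros_zero` — under `Λ < 0` the zeros `x_j(0)` of `H_0` are the numbers
  `2γ_{j−1}`, `γ_0 ≤ γ_1 ≤ ⋯` the ordinates of the zeros of `ζ` (`Literature.NumberTheory.LFunctions.zetaOrdinate`), and these
  are distinct (§1.2 and the last paragraph of §9 of the source; simplicity is the theorem of
  Csordas–Smith–Varga quoted there).

Proved here: the elementary API of `Ψ`, `ξ`, `V` (`Literature.NumberTheory.LFunctions.hasDerivAt_rodgersTaoPsi`,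
`Literature.NumberTheory.LFunctions.strictMonoOn_rodgersTaoPsi`, `Literature.NumberTheory.LFunctions.renormPotential_eq`, `Literature.NumberTheory.LFunctions.renormPotential_nonneg`,
`Literature.NumberTheory.LFunctions.sq_sub_one_le_renormPotential`, `Literature.NumberTheory.LFunctions.sub_one_le_renormPotential`, …).

## Design choices and junk conventions

* `Ψ` is decreasing on `(0, 4π]` and increasing on `[4π, ∞)`, with `Ψ(4π) = −1` and `Ψ(4πe) = 0`
  (the source's "(1, +∞)" and "`Ψ` is increasing for `T > 1`" take the factors `4π` lightly, as
  its footnote 6 announces); for `j ≥ 1` the unique solution of `Ψ(ξ) = j` in `(1, ∞)` is the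
  unique solution in `[4π, ∞)`, which is what `classicalLocation` returns. It is defined for all
  real `y` by an `sInf` over `{ξ | 4π ≤ ξ ∧ y ≤ Ψ ξ}`; for `y < −1` this gives the junk value `4π`.
* `N_t(I)` counts *distinct* real zeros (`Set.ncard`, junk `0` for an infinite zero set, which
  cannot occur: `H_t` is entire and `H_t(0) ≠ 0`). For `Λ < t ≤ 0` the zeros of `H_t` are real and
  simple (Csordas–Smith–Varga, quoted in §1.2 and §3 of the source), so this is the count of §3.
* `x_j(t) = inf {X ≥ 0 | j ≤ N_t([0,X])}`: for `j = 0` this is `0` (the index `0` is unused in the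
  source, which indexes by `ℤ* = ℤ ∖ {0}` with `x_{−j} = −x_j`; only `j ≥ 1` occurs below), and it
  is the junk value `0` if `H_t` has fewer than `j` positive real zeros.
* `V(0) = −3` by `0⁻¹ = 0` (the source never evaluates `V` at `0`: the zeros are distinct);
  `V(x) = (|x| − 1)²(2|x| + 1)/x² ≥ 0` for `x ≠ 0` (`renormPotential_eq`).
* Discrete intervals `[T log T, 2T log T]_{ℤ*}` are rendered `Finset.Icc ⌈T log T⌉₊ ⌊2T log T⌋₊`
  as in `RodgersTao.lean`, and `o_{T→∞}(T log³ T)` for the non-negative quantity `Ẽ` as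
  `∀ ε > 0, ∃ T₀, ∀ T ≥ T₀, Ẽ ≤ ε T log³ T`.

## References

* B. Rodgers, T. Tao, *The de Bruijn–Newman constant is non-negative*, Forum Math. Pi 8 (2020),
  e6; arXiv:1801.05914: §1.2, §3 (eq. (8)–(10), Lemma 3.1), §7 (definition of `V`, `Ẽ`,
  Thm. 7.2), Prop. 8.1, Prop. 8.2, §9.
* G. Csordas, W. Smith, R. S. Varga, *Lehmer pairs of zeros, the de Bruijn–Newman constant `Λ`,
  and the Riemann Hypothesis*, Constr. Approx. 10 (1994), 107–129.
-/

noncomputable section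

open Real Filter Set

namespace Literature.NumberTheory.LFunctions

/-! ## `Ψ` and the classical locations `ξ` (§3) -/

/-- `Ψ(T) = (T/4π) log(T/4π) − T/4π`, the main term in the Riemann–von Mangoldt formula for the
zeros of `H_0(z) = ξ(1/2 + iz/2)/8` in `[0, T]` (Rodgers–Tao 2020, §3, eq. (8); the traditional
`−7/8… + 7/8`-type constant is discarded there). [cite: RodgersTaoFMP2020, §3 eq. (8)] -/
def rodgersTaoPsi (T : ℝ) : ℝ :=
  T / (4 * π) * Real.log (T / (4 * π)) - T / (4 * π)

/-- Unfolding lemma for `Ψ`. [folklore] -/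
theorem rodgersTaoPsi_eq (T : ℝ) :
    rodgersTaoPsi T = T / (4 * π) * Real.log (T / (4 * π)) - T / (4 * π) := rfl

/-- `Ψ(4π) = −1`. [folklore] -/
@[simp] theorem rodgersTaoPsi_four_pi : rodgersTaoPsi (4 * π) = -1 := by
  have h : (4 * π) / (4 * π) = 1 := div_self (by positivity)
  rw [rodgersTaoPsi, h, Real.log_one, mul_zero, zero_sub]

/-- `Ψ'(T) = log(T/4π)/(4π)` for `T ≠ 0` (Rodgers–Tao 2020, §3, eq. (9), up to the harmless slip
`log T` for `log(T/4π)` there). [cite: RodgersTaoFMP2020, §3 eq. (9)] -/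
theorem hasDerivAt_rodgersTaoPsi {T : ℝ} (hT : T ≠ 0) :
    HasDerivAt rodgersTaoPsi (Real.log (T / (4 * π)) / (4 * π)) T := by
  have h4 : (4 * π) ≠ 0 := by positivity
  have hu : HasDerivAt (fun T : ℝ ↦ T / (4 * π)) (1 / (4 * π)) T := by
    simpa using (hasDerivAt_id T).div_const (4 * π)
  have hne : T / (4 * π) ≠ 0 := div_ne_zero hT h4
  have h1 : HasDerivAt (fun T : ℝ ↦ T / (4 * π) * Real.log (T / (4 * π)))
      ((Real.log (T / (4 * π)) + 1) * (1 / (4 * π))) T := by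
    have := (Real.hasDerivAt_mul_log hne).comp T hu
    simpa [Function.comp_def] using this
  have h2 : HasDerivAt (fun T : ℝ ↦ T / (4 * π) * Real.log (T / (4 * π)) - T / (4 * π))
      ((Real.log (T / (4 * π)) + 1) * (1 / (4 * π)) - 1 / (4 * π)) T := h1.sub hu
  have h3 : (Real.log (T / (4 * π)) + 1) * (1 / (4 * π)) - 1 / (4 * π) =
      Real.log (T / (4 * π)) / (4 * π) := by ring
  rw [h3] at h2
  exact h2

/-- `Ψ` is continuous. [folklore] -/
theorem continuous_rodgersTaoPsi : Continuous rodgersTaoPsi := by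
  have h : Continuous fun T : ℝ ↦ T / (4 * π) := continuous_id.div_const _
  exact (Real.continuous_mul_log.comp h).sub h

/-- `Ψ` is strictly increasing on `[4π, ∞)` (its derivative `log(T/4π)/(4π)` is positive for
`T > 4π`). [folklore] -/
theorem strictMonoOn_rodgersTaoPsi : StrictMonoOn rodgersTaoPsi (Ici (4 * π)) := by
  refine strictMonoOn_of_deriv_pos (convex_Ici _) continuous_rodgersTaoPsi.continuousOn ?_
  intro T hT
  rw [interior_Ici] at hT
  have hπ : 0 < 4 * π := by positivity
  have hT0 : T ≠ 0 := (hπ.trans hT).ne'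
  rw [(hasDerivAt_rodgersTaoPsi hT0).deriv]
  exact div_pos (Real.log_pos ((one_lt_div hπ).2 hT)) hπ

/-- `Ψ(4π e^{y+2}) = e^{y+2} (y + 1)`. [folklore] -/
theorem rodgersTaoPsi_four_pi_mul_exp (y : ℝ) :
    rodgersTaoPsi (4 * π * Real.exp (y + 2)) = Real.exp (y + 2) * (y + 1) := by
  have h : 4 * π * Real.exp (y + 2) / (4 * π) = Real.exp (y + 2) := by
    field_simp
  rw [rodgersTaoPsi, h, Real.log_exp]
  ring

/-- For `y ≥ −1` there is `ξ ≥ 4π` with `Ψ(ξ) = y` (intermediate value theorem on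
`[4π, 4π e^{y+2}]`). [folklore] -/
theorem exists_rodgersTaoPsi_eq {y : ℝ} (hy : -1 ≤ y) :
    ∃ ξ : ℝ, 4 * π ≤ ξ ∧ rodgersTaoPsi ξ = y := by
  have hπ : 0 < 4 * π := by positivity
  have hle : 4 * π ≤ 4 * π * Real.exp (y + 2) := by
    have : (1 : ℝ) ≤ Real.exp (y + 2) := Real.one_le_exp (by linarith)
    nlinarith
  have hmem : y ∈ Icc (rodgersTaoPsi (4 * π)) (rodgersTaoPsi (4 * π * Real.exp (y + 2))) := by
    rw [rodgersTaoPsi_four_pi, rodgersTaoPsi_four_pi_mul_exp]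
    refine ⟨hy, ?_⟩
    have h1 : (1 : ℝ) ≤ Real.exp (y + 2) := Real.one_le_exp (by linarith)
    nlinarith
  obtain ⟨ξ, hξ, hξy⟩ :=
    intermediate_value_Icc hle continuous_rodgersTaoPsi.continuousOn hmem
  exact ⟨ξ, hξ.1, hξy⟩

/-- The classical location `ξ_y`: the unique `ξ ≥ 4π` with `Ψ(ξ) = y`, for real `y ≥ −1`
(Rodgers–Tao 2020, §3, display (10), for integer `y = j ≥ 1`: "the unique quantity in `(1,+∞)`
solving `Ψ(ξ_j) = j`"; since `Ψ < 0` on `(0, 4πe)`, for `j ≥ 1` that solution is the one in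
`[4π, ∞)`). Realised as `inf {ξ | 4π ≤ ξ ∧ y ≤ Ψ(ξ)}`; junk value `4π` for `y < −1`. Explicitly
`ξ_y = 4πe · exp(W(y/e))` with Lambert's `W` (footnote 8 of the source, not used).
[cite: RodgersTaoFMP2020, §3 eq. (10)] -/
def classicalLocation (y : ℝ) : ℝ :=
  sInf {ξ : ℝ | 4 * π ≤ ξ ∧ y ≤ rodgersTaoPsi ξ}

/-- A solution `ξ ≥ 4π` of `Ψ(ξ) = y` is the least element of `{ξ | 4π ≤ ξ ∧ y ≤ Ψ ξ}`. [folklore] -/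
theorem isLeast_of_rodgersTaoPsi_eq {y ξ : ℝ} (hξ : 4 * π ≤ ξ) (h : rodgersTaoPsi ξ = y) :
    IsLeast {ξ : ℝ | 4 * π ≤ ξ ∧ y ≤ rodgersTaoPsi ξ} ξ := by
  refine ⟨⟨hξ, h.ge⟩, fun ξ' hξ' ↦ ?_⟩
  rcases lt_or_ge ξ' ξ with hlt | hge
  · have := strictMonoOn_rodgersTaoPsi (show ξ' ∈ Ici (4 * π) from hξ'.1)
      (show ξ ∈ Ici (4 * π) from hξ) hlt
    linarith [hξ'.2]
  · exact hge

/-- Uniqueness: if `ξ ≥ 4π` and `Ψ(ξ) = y` then `ξ_y = ξ`. [folklore] -/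
theorem classicalLocation_eq {y ξ : ℝ} (hξ : 4 * π ≤ ξ) (h : rodgersTaoPsi ξ = y) :
    classicalLocation y = ξ :=
  (isLeast_of_rodgersTaoPsi_eq hξ h).csInf_eq

/-- For `y ≥ −1`: `4π ≤ ξ_y` and `Ψ(ξ_y) = y`. [folklore] -/
theorem classicalLocation_spec {y : ℝ} (hy : -1 ≤ y) :
    4 * π ≤ classicalLocation y ∧ rodgersTaoPsi (classicalLocation y) = y := by
  obtain ⟨ξ, hξ, h⟩ := exists_rodgersTaoPsi_eq hy
  rw [classicalLocation_eq hξ h]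
  exact ⟨hξ, h⟩

/-- `Ψ(ξ_y) = y` for `y ≥ −1` (Rodgers–Tao 2020, §3, (10)). [cite: RodgersTaoFMP2020, §3 eq. (10)] -/
theorem rodgersTaoPsi_classicalLocation {y : ℝ} (hy : -1 ≤ y) :
    rodgersTaoPsi (classicalLocation y) = y :=
  (classicalLocation_spec hy).2

/-- `4π ≤ ξ_y` for `y ≥ −1`. [folklore] -/
theorem four_pi_le_classicalLocation {y : ℝ} (hy : -1 ≤ y) : 4 * π ≤ classicalLocation y :=
  (classicalLocation_spec hy).1

/-- `0 < ξ_y` for `y ≥ −1`. [folklore] -/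
theorem classicalLocation_pos {y : ℝ} (hy : -1 ≤ y) : 0 < classicalLocation y :=
  lt_of_lt_of_le (by positivity) (four_pi_le_classicalLocation hy)

/-- `ξ_{Ψ(ξ)} = ξ` for `ξ ≥ 4π`: `ξ` inverts `Ψ` on `[4π, ∞)`. [folklore] -/
theorem classicalLocation_rodgersTaoPsi {ξ : ℝ} (hξ : 4 * π ≤ ξ) :
    classicalLocation (rodgersTaoPsi ξ) = ξ :=
  classicalLocation_eq hξ rfl

/-- The classical locations are strictly increasing in `y ≥ −1` ("Clearly the `ξ_j` are increasing
in `j`", §3 of the source). [cite: RodgersTaoFMP2020, §3] -/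
theorem strictMonoOn_classicalLocation : StrictMonoOn classicalLocation (Ici (-1)) := by
  intro y hy y' hy' hlt
  by_contra hle
  replace hle := le_of_not_gt hle
  have hmono := strictMonoOn_rodgersTaoPsi.monotoneOn
    (show classicalLocation y' ∈ Ici (4 * π) from four_pi_le_classicalLocation hy')
    (show classicalLocation y ∈ Ici (4 * π) from four_pi_le_classicalLocation hy) hle
  rw [rodgersTaoPsi_classicalLocation hy, rodgersTaoPsi_classicalLocation hy'] at hmono
  exact absurd hlt (not_lt.2 hmono)

/-- `ξ` is order-preserving and reflecting on `[−1, ∞)`: `ξ_y ≤ ξ_{y'} ↔ y ≤ y'`. [folklore] -/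
theorem classicalLocation_le_iff {y y' : ℝ} (hy : -1 ≤ y) (hy' : -1 ≤ y') :
    classicalLocation y ≤ classicalLocation y' ↔ y ≤ y' :=
  strictMonoOn_classicalLocation.le_iff_le hy hy'

/-- Comparison with `Ψ`: for `y ≥ −1` and `X ≥ 4π`, `ξ_y ≤ X ↔ y ≤ Ψ(X)`. [folklore] -/
theorem classicalLocation_le_iff_le_rodgersTaoPsi {y X : ℝ} (hy : -1 ≤ y) (hX : 4 * π ≤ X) :
    classicalLocation y ≤ X ↔ y ≤ rodgersTaoPsi X := by
  have hX' : -1 ≤ rodgersTaoPsi X := by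
    rw [← rodgersTaoPsi_four_pi]
    exact strictMonoOn_rodgersTaoPsi.monotoneOn (self_mem_Ici) hX hX
  rw [← classicalLocation_le_iff hy hX', classicalLocation_rodgersTaoPsi hX]

/-- Comparison with `Ψ`: for `y ≥ −1` and `X ≥ 4π`, `X ≤ ξ_y ↔ Ψ(X) ≤ y`. [folklore] -/
theorem le_classicalLocation_iff_rodgersTaoPsi_le {y X : ℝ} (hy : -1 ≤ y) (hX : 4 * π ≤ X) :
    X ≤ classicalLocation y ↔ rodgersTaoPsi X ≤ y := by
  have hX' : -1 ≤ rodgersTaoPsi X := by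
    rw [← rodgersTaoPsi_four_pi]
    exact strictMonoOn_rodgersTaoPsi.monotoneOn (self_mem_Ici) hX hX
  rw [← classicalLocation_le_iff hX' hy, classicalLocation_rodgersTaoPsi hX]

/-! ## The real zeros of `H_t` (§1.2, §3) -/

/-- `N_t(I)`: the number of (distinct) real zeros of `H_t` lying in `I ⊆ ℝ` (Rodgers–Tao 2020,
§3: "for any interval `I ⊂ ℝ`, let `N_t(I)` denote the number of zeroes of `H_t` in `I`"; for
`Λ < t ≤ 0` all zeros of `H_t` are real and simple, so no multiplicities arise). `Set.ncard`, hence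
`0` for an infinite zero set (impossible: `H_t` is entire with `H_t(0) ≠ 0`).
[cite: RodgersTaoFMP2020, §3] -/
def deBruijnZeroCount (t : ℝ) (I : Set ℝ) : ℕ :=
  {x : ℝ | x ∈ I ∧ deBruijnH t x = 0}.ncard

/-- Unfolding lemma for `N_t(I)`. [folklore] -/
theorem deBruijnZeroCount_eq (t : ℝ) (I : Set ℝ) :
    deBruijnZeroCount t I = {x : ℝ | x ∈ I ∧ deBruijnH t x = 0}.ncard := rfl

/-- `N_t(∅) = 0`. [folklore] -/
@[simp] theorem deBruijnZeroCount_empty (t : ℝ) : deBruijnZeroCount t ∅ = 0 := by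
  simp [deBruijnZeroCount]

/-- `N_t` is monotone in `I` as long as the larger zero set is finite. [folklore] -/
theorem deBruijnZeroCount_mono (t : ℝ) {I J : Set ℝ} (h : I ⊆ J)
    (hJ : {x : ℝ | x ∈ J ∧ deBruijnH t x = 0}.Finite) :
    deBruijnZeroCount t I ≤ deBruijnZeroCount t J :=
  Set.ncard_le_ncard (fun _ hx ↦ ⟨h hx.1, hx.2⟩) hJ

/-- `x_j(t)`, the `j`-th positive real zero of `H_t` (`j ≥ 1`): `inf {X ≥ 0 | j ≤ N_t([0, X])}`
(Rodgers–Tao 2020, §1.2: for `Λ < t ≤ 0` the zeros of `H_t` are real, simple and avoid the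
origin, `0 < x_1(t) < x_2(t) < ⋯`, `x_{−j}(t) = −x_j(t)`). Conventions: `x_0(t) = 0` (the index
`0` is not used in the source), and the junk value `0` (`sInf ∅`) if `H_t` has fewer than `j`
positive real zeros. [cite: RodgersTaoFMP2020, §1.2] -/
def deBruijnZero (t : ℝ) (j : ℕ) : ℝ :=
  sInf {X : ℝ | 0 ≤ X ∧ j ≤ deBruijnZeroCount t (Icc 0 X)}

/-- Unfolding lemma for `x_j(t)`. [folklore] -/
theorem deBruijnZero_eq (t : ℝ) (j : ℕ) :
    deBruijnZero t j = sInf {X : ℝ | 0 ≤ X ∧ j ≤ deBruijnZeroCount t (Icc 0 X)} := rfl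

/-- `x_0(t) = 0`. [folklore] -/
@[simp] theorem deBruijnZero_zero (t : ℝ) : deBruijnZero t 0 = 0 := by
  rw [deBruijnZero]
  have : {X : ℝ | 0 ≤ X ∧ 0 ≤ deBruijnZeroCount t (Icc 0 X)} = Ici 0 := by
    ext X; simp
  rw [this, csInf_Ici]

/-- `0 ≤ x_j(t)` (including the junk case). [folklore] -/
theorem deBruijnZero_nonneg (t : ℝ) (j : ℕ) : 0 ≤ deBruijnZero t j := by
  rw [deBruijnZero]
  rcases Set.eq_empty_or_nonempty {X : ℝ | 0 ≤ X ∧ j ≤ deBruijnZeroCount t (Icc 0 X)} with h | h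
  · rw [h, Real.sInf_empty]
  · exact le_csInf h fun X hX ↦ hX.1

/-! ## The potential `V` and the renormalised energy (§7) -/

/-- `V(x) = 1/|x|² − 1 + 2(|x| − 1)`: `1/x²` minus its linearisation at `x = 1` (Rodgers–Tao 2020,
§7). Junk: `V(0) = −3` by `0⁻¹ = 0` (never used at `0` in the source).
[cite: RodgersTaoFMP2020, §7 (definition of V)] -/
def renormPotential (x : ℝ) : ℝ :=
  1 / x ^ 2 - 1 + 2 * (|x| - 1)

/-- Unfolding lemma for `V`. [folklore] -/
theorem renormPotential_eq_def (x : ℝ) : renormPotential x = 1 / x ^ 2 - 1 + 2 * (|x| - 1) := rfl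

/-- `V(1) = 0`: the equilibrium (arithmetic progression) has zero renormalised energy. [folklore] -/
@[simp] theorem renormPotential_one : renormPotential 1 = 0 := by
  norm_num [renormPotential]

/-- `V` is even. [folklore] -/
theorem renormPotential_neg (x : ℝ) : renormPotential (-x) = renormPotential x := by
  simp [renormPotential]

/-- `V(|x|) = V(x)`. [folklore] -/
theorem renormPotential_abs (x : ℝ) : renormPotential |x| = renormPotential x := by
  simp [renormPotential]

/-- The factorisation `V(x) = (|x| − 1)² (2|x| + 1) / x²` for `x ≠ 0`. [folklore] -/
theorem renormPotential_eq {x : ℝ} (hx : x ≠ 0) :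
    renormPotential x = (|x| - 1) ^ 2 * (2 * |x| + 1) / x ^ 2 := by
  have hx2 : x ^ 2 ≠ 0 := pow_ne_zero 2 hx
  have habs : |x| ^ 2 = x ^ 2 := sq_abs x
  rw [renormPotential, eq_div_iff hx2]
  field_simp
  nlinarith [habs]

/-- `V ≥ 0` away from the junk point `0` ("As `1/x²` is convex, `V` is non-negative", §7).
[cite: RodgersTaoFMP2020, §7] -/
theorem renormPotential_nonneg {x : ℝ} (hx : x ≠ 0) : 0 ≤ renormPotential x := by
  rw [renormPotential_eq hx]
  positivity

/-- `(|x| − 1)² ≤ V(x)` for `0 < |x| ≤ 2` (the regime `V(x) ≍ (|x| − 1)²` of display (vlog), §7,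
with an explicit constant). [cite: RodgersTaoFMP2020, §7 eq. (vlog)] -/
theorem sq_sub_one_le_renormPotential {x : ℝ} (hx : x ≠ 0) (h2 : |x| ≤ 2) :
    (|x| - 1) ^ 2 ≤ renormPotential x := by
  rw [renormPotential_eq hx, le_div_iff₀ (by positivity), ← sq_abs x]
  have h0 : 0 < |x| := abs_pos.2 hx
  have hA : 0 ≤ 2 * |x| + 1 - |x| ^ 2 := by nlinarith
  nlinarith [mul_nonneg (sq_nonneg (|x| - 1)) hA]

/-- `|x| − 1 ≤ V(x)` for `|x| ≥ 2` (the regime `V(x) ≍ |x|` of display (vlog), §7, with an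
explicit constant); in particular `V(x) ≥ 1` there. [cite: RodgersTaoFMP2020, §7 eq. (vlog)] -/
theorem sub_one_le_renormPotential {x : ℝ} (h : 2 ≤ |x|) : |x| - 1 ≤ renormPotential x := by
  have hx : x ≠ 0 := abs_pos.1 (by linarith)
  rw [renormPotential_eq hx, le_div_iff₀ (by positivity), ← sq_abs x]
  have h1 : 0 ≤ |x| - 1 := by linarith
  have hq : 0 ≤ |x| ^ 2 - |x| - 1 := by nlinarith
  nlinarith [mul_nonneg h1 hq]

/-- If `x ≠ 0` and `V(x) < δ ≤ 1` then `(|x| − 1)² < δ`: small renormalised energy forces the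
normalised gap towards `1` ("using the properties (vlog) of the function `V`", §9).
[cite: RodgersTaoFMP2020, §9] -/
theorem sq_sub_one_lt_of_renormPotential_lt {x δ : ℝ} (hx : x ≠ 0) (hδ : δ ≤ 1)
    (h : renormPotential x < δ) : (|x| - 1) ^ 2 < δ := by
  have h2 : |x| ≤ 2 := by
    by_contra h2
    have := sub_one_le_renormPotential (x := x) (by linarith [lt_of_not_ge h2])
    linarith [lt_of_not_ge h2]
  exact (sq_sub_one_le_renormPotential hx h2).trans_lt h

/-- The renormalised interaction energy `Ẽ_{jk}(t) = V((x_k(t) − x_j(t))/(ξ_k − ξ_j)) / |ξ_k − ξ_j|²`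
of the zeros `x_j(t)`, `x_k(t)` of `H_t`, `j ≠ k` positive indices (Rodgers–Tao 2020, §7).
[cite: RodgersTaoFMP2020, §7 (definition of Ẽ_jk)] -/
def renormEnergy (t : ℝ) (j k : ℕ) : ℝ :=
  renormPotential ((deBruijnZero t k - deBruijnZero t j) /
      (classicalLocation k - classicalLocation j)) /
    (classicalLocation k - classicalLocation j) ^ 2

/-- Unfolding lemma for `Ẽ_{jk}(t)`. [folklore] -/
theorem renormEnergy_eq (t : ℝ) (j k : ℕ) :
    renormEnergy t j k = renormPotential ((deBruijnZero t k - deBruijnZero t j) /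
      (classicalLocation k - classicalLocation j)) / (classicalLocation k - classicalLocation j) ^ 2 :=
  rfl

/-- `Ẽ_{jk}(t) = Ẽ_{kj}(t)` (`V` is even). [folklore] -/
theorem renormEnergy_comm (t : ℝ) (j k : ℕ) : renormEnergy t j k = renormEnergy t k j := by
  simp only [renormEnergy]
  have h1 : (deBruijnZero t j - deBruijnZero t k) / (classicalLocation j - classicalLocation k) =
      (deBruijnZero t k - deBruijnZero t j) / (classicalLocation k - classicalLocation j) := by
    rw [← neg_sub (deBruijnZero t k), ← neg_sub (classicalLocation (k : ℝ)), neg_div_neg_eq]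
  have h2 : (classicalLocation (j : ℝ) - classicalLocation k) ^ 2 =
      (classicalLocation (k : ℝ) - classicalLocation j) ^ 2 := by ring
  rw [h1, h2]

/-- The renormalised energy `Ẽ^I(t) = Σ_{j,k ∈ I, j ≠ k} Ẽ_{jk}(t)` of a finite set `I` of positive
indices (Rodgers–Tao 2020, §7, for discrete intervals `I`). [cite: RodgersTaoFMP2020, §7 (definition of Ẽ^I)] -/
def renormEnergyOn (t : ℝ) (I : Finset ℕ) : ℝ :=
  ∑ p ∈ I.offDiag, renormEnergy t p.1 p.2

/-- Unfolding lemma for `Ẽ^I(t)`. [folklore] -/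
theorem renormEnergyOn_eq (t : ℝ) (I : Finset ℕ) :
    renormEnergyOn t I = ∑ p ∈ I.offDiag, renormEnergy t p.1 p.2 := rfl

/-- `Ẽ^∅(t) = 0`. [folklore] -/
@[simp] theorem renormEnergyOn_empty (t : ℝ) : renormEnergyOn t ∅ = 0 := by
  simp [renormEnergyOn]

end Literature.NumberTheory.LFunctions

/-! ## Named facts: Prop. 8.1 and the zeros at time zero -/

namespace Literature.NumberTheory.LFunctions

/-- NAMED FACT (Rodgers–Tao 2020, **Proposition 8.1**, energy bound at time zero; it is the
outcome of §§2–8: Riemann–von Mangoldt for `H_t`, the Csordas–Smith–Varga dynamics, the gap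
bound Prop. 5.1, the integrated energy bounds Prop. 6.1 and Thm. 7.2, and the propagation
inequality Prop. 8.2). Assume `Λ < 0`, i.e. `H_{t₀}` has only real zeros for some `t₀ < 0`. Then
`Ẽ^{[T log T, 2T log T]}(0) = o_{T → ∞}(T log³ T)`: for every `ε > 0` and all sufficiently large
`T`, `Σ_{j ≠ k ∈ [T log T, 2T log T]} Ẽ_{jk}(0) ≤ ε T log³ T`, where
`Ẽ_{jk}(0) = V((x_k(0) − x_j(0))/(ξ_k − ξ_j))/|ξ_k − ξ_j|²` (`Literature.NumberTheory.LFunctions.renormEnergyOn`). Users take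
`(h : rodgers_tao_energy_bound_zero)`. [cite: RodgersTaoFMP2020, Prop. 8.1] -/
def rodgers_tao_energy_bound_zero : Prop :=
  (∃ t : ℝ, t < 0 ∧ HasOnlyRealZeros (deBruijnH t)) →
    ∀ ε : ℝ, 0 < ε → ∃ T₀ : ℝ, ∀ T : ℝ, T₀ ≤ T →
      renormEnergyOn 0 (Finset.Icc ⌈T * Real.log T⌉₊ ⌊2 * T * Real.log T⌋₊) ≤
        ε * (T * Real.log T ^ 3)

/-- NAMED FACT (Rodgers–Tao 2020, §1.2 with §9). Assume `Λ < 0`, i.e. `H_{t₀}` has only real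
zeros for some `t₀ < 0`. Then the Riemann hypothesis holds, the zeros of `H_0(z) = ξ(1/2 + iz/2)/8`
are real, simple and avoid the origin, `0 < x_1(0) < x_2(0) < ⋯` (Csordas–Smith–Varga, as quoted
in §1.2), and "the points `x_j(0)` are twice the imaginary ordinates of nontrivial zeroes of the
Riemann zeta function" (§9): `x_{n+1}(0) = 2γ_n` for all `n ≥ 0`, where `γ_0 ≤ γ_1 ≤ ⋯` are the
ordinates of the zeros of `ζ` in the upper half-plane repeated according to multiplicity
(`Literature.NumberTheory.LFunctions.zetaOrdinate`), which are therefore pairwise distinct. Users take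
`(h : rodgers_tao_zeros_zero)`. [cite: RodgersTaoFMP2020, §1.2 and §9] -/
def rodgers_tao_zeros_zero : Prop :=
  (∃ t : ℝ, t < 0 ∧ HasOnlyRealZeros (deBruijnH t)) →
    (∀ n : ℕ, deBruijnZero 0 (n + 1) = 2 * zetaOrdinate n) ∧ StrictMono zetaOrdinate

/-- NAMED FACT (Rodgers–Tao 2020, **Theorem 7.2**, strong control on integrated energy; it rests
on §§2–7: Riemann–von Mangoldt for `H_t`, the dynamics Thm. 4.1, the gap bound Prop. 5.1, the
weak integrated bound Prop. 6.1 and the Hamiltonian monotonicity of §7). Assume `H_{t₀}` has only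
real zeros for some `t₀ < 0` (so `Λ ≤ t₀ < 0`). Then for every `ε > 0` and all sufficiently large
`T`, the renormalised energy of the window `[½ T log T, 3T log T]` satisfies
`∫_{t₀/4}^{0} Ẽ^{[½T log T, 3T log T]}(t) dt ≤ ε T log³ T`, the integrand being integrable on
`[t₀/4, 0]`. (The source integrates over `[Λ/4, 0] ⊇ [t₀/4, 0]`; the integrand is non-negative,
and it is integrable by Prop. 6.1 and the continuity of the zeros in `t`, Thm. 4.1.) Users take
`(h : rodgers_tao_integrated_energy_bound)`. [cite: RodgersTaoFMP2020, Thm. 7.2] -/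
def rodgers_tao_integrated_energy_bound : Prop :=
  ∀ t₀ : ℝ, t₀ < 0 → HasOnlyRealZeros (deBruijnH t₀) →
    ∀ ε : ℝ, 0 < ε → ∃ T₀ : ℝ, ∀ T : ℝ, T₀ ≤ T →
      IntervalIntegrable
          (fun t ↦ renormEnergyOn t
            (Finset.Icc ⌈T * Real.log T / 2⌉₊ ⌊3 * T * Real.log T⌋₊))
          MeasureTheory.volume (t₀ / 4) 0 ∧
        ∫ t in (t₀ / 4)..0, renormEnergyOn t
            (Finset.Icc ⌈T * Real.log T / 2⌉₊ ⌊3 * T * Real.log T⌋₊) ≤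
          ε * (T * Real.log T ^ 3)

/-- NAMED FACT (Rodgers–Tao 2020, **Proposition 8.2**, energy propagation inequality; proved
there by Bourgain's pigeonholing argument from Lemma 4.2, Cor. 3.3 and Lemma 7.1). Assume
`H_{t₀}` has only real zeros for some `t₀ < 0` (so `Λ ≤ t₀ < 0`). There are constants `A`, `C`
and `T₀` such that for all `T ≥ T₀`, all real `I₁ ∈ [½ T log T, T log T]`,
`I₂ ∈ [2T log T, 3T log T]` (so that `I = [I₁, I₂] ⊇ [T log T, 2T log T]`), and all
`t₀/4 ≤ t₁ ≤ t₂ ≤ 0` with `t₂ ≤ t₁ + 1/(100 log² T)`: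
`Ẽ^{I'}(t₂) ≤ Ẽ^{I}(t₁) + C log^A T`, where `I' = [I₁ + log³ T, I₂ − log³ T]` ("`Õ(1)`" of the
source is `O(log^{O(1)} T)`; the source allows `Λ/4 ≤ t₁`). Discrete intervals with real
endpoints are `Finset.Icc ⌈·⌉₊ ⌊·⌋₊`. Users take `(h : rodgers_tao_energy_propagation)`.
[cite: RodgersTaoFMP2020, Prop. 8.2] -/
def rodgers_tao_energy_propagation : Prop :=
  ∀ t₀ : ℝ, t₀ < 0 → HasOnlyRealZeros (deBruijnH t₀) →
    ∃ A C T₀ : ℝ, ∀ T : ℝ, T₀ ≤ T → ∀ I₁ I₂ : ℝ,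
      T * Real.log T / 2 ≤ I₁ → I₁ ≤ T * Real.log T →
      2 * T * Real.log T ≤ I₂ → I₂ ≤ 3 * T * Real.log T →
      ∀ t₁ t₂ : ℝ, t₀ / 4 ≤ t₁ → t₁ ≤ t₂ → t₂ ≤ 0 →
        t₂ ≤ t₁ + 1 / (100 * Real.log T ^ 2) →
        renormEnergyOn t₂ (Finset.Icc ⌈I₁ + Real.log T ^ 3⌉₊ ⌊I₂ - Real.log T ^ 3⌋₊) ≤
          renormEnergyOn t₁ (Finset.Icc ⌈I₁⌉₊ ⌊I₂⌋₊) + C * Real.log T ^ A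

end Literature.NumberTheory.LFunctions

end
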